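import Literature.MathematicalPhysics.QuantumLattice.TorusBandClosedShells
import Literature.MathematicalPhysics.QuantumLattice.FreeFermionSectorGroundStates
import HarnessLib

/-!
# The Fermi level of a doped sector lies in `[-2, 0]` (solo-blind programme, Theorem 27, part 3)

For even `L` and a Fermi set `F` of the free torus band (filled below, empty above some value)
with `L²/4 ≤ #F < L²/2` — the per-spin filling of the sector `N = 2⌊(1-δ)L²/2⌋` of the summit
statement for `δ ∈ (0, 1/2)` and `L² ≥ 4/(1-2δ)` (`sector_card_bounds`) — there is a separating
level `μ ∈ [-2, 0]`: `ε_L(k) ≤ μ` on `F` and `μ ≤ ε_L(k)` off `F` (`exists_level_mem_Icc`,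
`exists_fermiSet_level`). Ingredients: the particle–hole count `L² < 2·#{ε_L ≤ 0}` of the tree
(`sq_lt_two_mul_card_filter_torusBand_le_zero`) and the bottom count
`#{ε_L < -2} ≤ #{cos(2πa/L) > 0}² ≤ L²/4` (the half-zone shift maps `{cos > 0}` into `{cos < 0}`).
This supplies the hypothesis `μ ∈ [-2, 0]` of the shell-window constructions
(`SoloBlindFermiSurfaceDOS`, `SoloBlindFermiSurfaceWindows`) at the sector's own Fermi level,
where `minEnergyOn_szSector_free_eq` evaluates the free sector ground-state energy
(report §5.20 (6), item E5b; claim C53). [this work; elementary]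
-/

noncomputable section

namespace Summit.HubbardSuperconductivity.HubbardSuperconductivity.Theorems.FermiLevel

open Finset Real Literature.Probability.LatticeModels Literature.MathematicalPhysics.QuantumLattice

variable {L : ℕ} [NeZero L]

/-- The half-zone shift flips the lattice cosine (even `L`). [folklore] -/
theorem cos_val_add_half (hL : Even L) (a : ZMod L) :
    Real.cos (2 * π * (((a + ((L / 2 : ℕ) : ZMod L)).val : ℕ) : ℝ) / L) =
      -Real.cos (2 * π * ((a.val : ℕ) : ℝ) / L) := by
  have h := torusBand_add_halfShift hL (fun _ => a : TorusSite 2 L)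
  rw [torusBand_two_eq, torusBand_two_eq] at h
  simp only [Pi.add_apply] at h
  linarith

/-- At most half of the residues have a positive lattice cosine (even `L`). [folklore] -/
theorem two_mul_card_filter_cos_pos_le (hL : Even L) :
    2 * #(univ.filter fun a : ZMod L => 0 < Real.cos (2 * π * ((a.val : ℕ) : ℝ) / L)) ≤ L := by
  set T := univ.filter fun a : ZMod L => 0 < Real.cos (2 * π * ((a.val : ℕ) : ℝ) / L) with hT
  set T' := univ.filter fun a : ZMod L => Real.cos (2 * π * ((a.val : ℕ) : ℝ) / L) < 0 with hT'
  have hmaps : ∀ a ∈ T, a + ((L / 2 : ℕ) : ZMod L) ∈ T' := by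
    intro a ha
    rw [hT, mem_filter] at ha
    rw [hT', mem_filter, cos_val_add_half hL]
    exact ⟨mem_univ _, by linarith [ha.2]⟩
  have hinj : Set.InjOn (fun a : ZMod L => a + ((L / 2 : ℕ) : ZMod L)) T :=
    fun a _ b _ h => add_right_cancel h
  have h1 : #T ≤ #T' := card_le_card_of_injOn _ hmaps hinj
  have hdisj : Disjoint T T' := by
    rw [hT, hT', disjoint_filter]
    intro a _ h1 h2
    linarith
  have h2 : #T + #T' ≤ L := by
    rw [← card_union_of_disjoint hdisj]
    calc #(T ∪ T') ≤ #(univ : Finset (ZMod L)) := card_le_univ _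
      _ = L := by rw [card_univ, ZMod.card]
  omega

/-- The bottom of the band is small: `4 · #{ε_L < -2} ≤ L²` (even `L`). [this work] -/
theorem four_mul_card_filter_torusBand_lt_neg_two_le (hL : Even L) :
    4 * #(univ.filter fun k : TorusSite 2 L => torusBand L k < -2) ≤ L ^ 2 := by
  set T := univ.filter fun a : ZMod L => 0 < Real.cos (2 * π * ((a.val : ℕ) : ℝ) / L) with hT
  have hmaps : ∀ k ∈ (univ.filter fun k : TorusSite 2 L => torusBand L k < -2),
      (k 0, k 1) ∈ T ×ˢ T := by
    intro k hk
    rw [mem_filter] at hk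
    have h := hk.2
    rw [torusBand_two_eq] at h
    have c0 := Real.cos_le_one (2 * π * (((k 0).val : ℕ) : ℝ) / L)
    have c1 := Real.cos_le_one (2 * π * (((k 1).val : ℕ) : ℝ) / L)
    rw [mem_product, hT, mem_filter, mem_filter]
    exact ⟨⟨mem_univ _, by linarith⟩, ⟨mem_univ _, by linarith⟩⟩
  have hinj : Set.InjOn (fun k : TorusSite 2 L => (k 0, k 1))
      (univ.filter fun k : TorusSite 2 L => torusBand L k < -2) := by
    intro k _ k' _ h
    simp only [Prod.mk.injEq] at h
    funext i
    fin_cases i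
    · exact h.1
    · exact h.2
  have h1 := card_le_card_of_injOn _ hmaps hinj
  rw [card_product] at h1
  have h2 := two_mul_card_filter_cos_pos_le hL
  calc 4 * #(univ.filter fun k : TorusSite 2 L => torusBand L k < -2) ≤ 4 * (#T * #T) :=
        Nat.mul_le_mul_left 4 h1
    _ = (2 * #T) * (2 * #T) := by ring
    _ ≤ L * L := Nat.mul_le_mul h2 h2
    _ = L ^ 2 := (sq L).symm

/-- **Theorem 27c (the Fermi level of a doped sector).** Even `L`, a Fermi set `F` (filled below /
empty above `eF`) with `L² ≤ 4·#F` and `2·#F < L²`: there is a separating level `μ ∈ [-2, 0]`.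
[this work] -/
theorem exists_level_mem_Icc (hL : Even L) (F : Finset (TorusSite 2 L)) (eF : ℝ)
    (hF : ∀ k ∈ F, torusBand L k ≤ eF) (hF' : ∀ k ∉ F, eF ≤ torusBand L k)
    (h1 : L ^ 2 ≤ 4 * #F) (h2 : 2 * #F < L ^ 2) :
    ∃ μ : ℝ, -2 ≤ μ ∧ μ ≤ 0 ∧ (∀ k ∈ F, torusBand L k ≤ μ) ∧ (∀ k ∉ F, μ ≤ torusBand L k) := by
  have hne : (univ \ F).Nonempty := by
    rw [nonempty_iff_ne_empty, Ne, sdiff_eq_empty_iff_subset]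
    intro h
    have h3 : #(univ : Finset (TorusSite 2 L)) ≤ #F := card_le_card h
    rw [card_univ, card_torusSite_two] at h3
    omega
  obtain ⟨k₀, hk₀, hmin⟩ := exists_min_image (univ \ F) (torusBand L) hne
  have hk₀F : k₀ ∉ F := (mem_sdiff.1 hk₀).2
  refine ⟨torusBand L k₀, ?_, ?_, fun k hk => (hF k hk).trans (hF' k₀ hk₀F),
    fun k hk => hmin k (mem_sdiff.2 ⟨mem_univ _, hk⟩)⟩
  · -- `μ ≥ -2`: otherwise `insert k₀ F ⊆ {ε < -2}`, a set of size `≤ L²/4 ≤ #F`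
    by_contra hlt
    rw [not_le] at hlt
    have hsub : insert k₀ F ⊆ univ.filter fun k : TorusSite 2 L => torusBand L k < -2 := by
      intro k hk
      rw [mem_filter]
      refine ⟨mem_univ _, ?_⟩
      rcases mem_insert.1 hk with rfl | hk
      · exact hlt
      · exact lt_of_le_of_lt ((hF k hk).trans (hF' k₀ hk₀F)) hlt
    have h3 := card_le_card hsub
    rw [card_insert_of_notMem hk₀F] at h3
    have h4 := four_mul_card_filter_torusBand_lt_neg_two_le hL (L := L)
    omega
  · -- `μ ≤ 0`: otherwise `{ε ≤ 0} ⊆ F`, a set of size `> L²/2 > #F`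
    by_contra hlt
    rw [not_le] at hlt
    have hsub : (univ.filter fun k : TorusSite 2 L => torusBand L k ≤ 0) ⊆ F := by
      intro k hk
      rw [mem_filter] at hk
      by_contra hkF
      have := hmin k (mem_sdiff.2 ⟨mem_univ _, hkF⟩)
      linarith [hk.2]
    have h3 := card_le_card hsub
    have h4 := sq_lt_two_mul_card_filter_torusBand_le_zero (L := L) hL
    omega

/-- The same, packaged with the existence of the Fermi set of `n` momenta. [this work] -/
theorem exists_fermiSet_level (hL : Even L) {n : ℕ} (h1 : L ^ 2 ≤ 4 * n) (h2 : 2 * n < L ^ 2) :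
    ∃ (F : Finset (TorusSite 2 L)) (μ : ℝ), #F = n ∧ -2 ≤ μ ∧ μ ≤ 0 ∧
      (∀ k ∈ F, torusBand L k ≤ μ) ∧ (∀ k ∉ F, μ ≤ torusBand L k) := by
  have hn : n ≤ Fintype.card (TorusSite 2 L) := by rw [card_torusSite_two]; omega
  obtain ⟨F, eF, hcard, hF, hF'⟩ := exists_fermiSet (torusBand L) hn
  obtain ⟨μ, hμ1, hμ2, hFμ, hFμ'⟩ := exists_level_mem_Icc hL F eF hF hF' (by omega) (by omega)
  exact ⟨F, μ, hcard, hμ1, hμ2, hFμ, hFμ'⟩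

omit [NeZero L] in
/-- The filling of the summit statement satisfies the two counting hypotheses: for
`δ ∈ (0, 1/2)` and `4/(1-2δ) ≤ L²`, `n = ⌊(1-δ)L²/2⌋₊` has `L² ≤ 4n` and `2n < L²`. [this work] -/
theorem sector_card_bounds {δ : ℝ} (hδ0 : 0 < δ) (hδ1 : δ < 1 / 2) (hL : 0 < L)
    (hLδ : 4 / (1 - 2 * δ) ≤ (L : ℝ) ^ 2) :
    L ^ 2 ≤ 4 * ⌊(1 - δ) * (L : ℝ) ^ 2 / 2⌋₊ ∧ 2 * ⌊(1 - δ) * (L : ℝ) ^ 2 / 2⌋₊ < L ^ 2 := by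
  have hLr : (0 : ℝ) < L := by exact_mod_cast hL
  have hx0 : 0 ≤ (1 - δ) * (L : ℝ) ^ 2 / 2 := by
    have : 0 ≤ 1 - δ := by linarith
    positivity
  have hfl : (1 - δ) * (L : ℝ) ^ 2 / 2 - 1 < ⌊(1 - δ) * (L : ℝ) ^ 2 / 2⌋₊ := by
    have := Nat.lt_floor_add_one ((1 - δ) * (L : ℝ) ^ 2 / 2)
    linarith
  have hfl' : (⌊(1 - δ) * (L : ℝ) ^ 2 / 2⌋₊ : ℝ) ≤ (1 - δ) * (L : ℝ) ^ 2 / 2 := Nat.floor_le hx0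
  have hδ' : 0 < 1 - 2 * δ := by linarith
  rw [div_le_iff₀ hδ'] at hLδ
  constructor
  · have h : ((L : ℝ)) ^ 2 ≤ 4 * (⌊(1 - δ) * (L : ℝ) ^ 2 / 2⌋₊ : ℝ) := by nlinarith
    exact_mod_cast h
  · have h : 2 * (⌊(1 - δ) * (L : ℝ) ^ 2 / 2⌋₊ : ℝ) < ((L : ℝ)) ^ 2 := by nlinarith
    exact_mod_cast h

end Summit.HubbardSuperconductivity.HubbardSuperconductivity.Theorems.FermiLevel
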